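import Literature.Geometry.Lorentzian.KerrDeSitterMasterEquations
import HarnessLib

/-!
# The conjugation symmetry `(ω, m, λ) ↦ (−ω̄, −m, λ̄)` of the separated Teukolsky / master system on
# Kerr–de Sitter: mode solutions for `m` and `−m` correspond under complex conjugation

All parameters `(M, a, Λ, s, μ)` of the printed fixed-frequency equations are REAL, so complex
conjugation combined with `(ω, m, λ) ↦ (−conj ω, −m, conj λ)` (and `x ↦ −x` in the angular
variable `x = cos θ`) maps every coefficient of

* the radial Teukolsky equation STU 1998 (3.7) = Hatsuda 2020 (2.13) (`IsRadialTeukolskySolution`),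
* the angular equation Hatsuda 2020 (2.5) (`IsAngularTeukolskySolution`),
* the radial and angular MASTER equations of Casals–Teixeira da Costa 2022 (3.8), (3.6) with
  Klein–Gordon parameter `μ` (`IsMasterRadialSolution`, `IsMasterAngularSolution`, `ν ↦ −conj ν`),

to its complex conjugate (`K(−ω̄, −m) = −conj K(ω, m)` enters through `K²`, `isKΔ'`, `4isωΞr`;
the angular coefficient is mapped to its conjugate at `−x`). The horizon exponents satisfy
`B_h(−ω̄, −m) = conj B_h(ω, m)` and, for a positive real base `t`, `t^{conj z} = conj (t^z)`, so the
INGOING condition at `𝓗⁺` and the OUTGOING condition at `𝓗⁺_c` (CTdC Def. 3.3, generic bullets,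
as rendered in `KerrDeSitterTeukolskyRadial.lean`) are mapped onto each other; the pole exponents
`|m − s|/2` at `x = −1` and `|m + s|/2` at `x = 1` are SWAPPED by `(m, x) ↦ (−m, −x)`, so regularity
at the poles (CTdC Lemma 3.1) is preserved. Consequently

`HasMode M a Λ s (−conj ω) (−m) ↔ HasMode M a Λ s ω m` (`hasMode_negConj_iff`, NO hypothesis on
`s`), `NoModeIn` transfers to the reflected window under `2s ∈ ℤ` (`noModeIn_negConj`; the
admissibility `m − s ∈ ℤ` becomes `−m − s ∈ ℤ`), and the same for the master system with any `μ`
(`hasMasterMode_negConj_iff`, `noMasterModeIn_negConj`).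

This is the Kerr–de Sitter form of the standard symmetry of the Teukolsky system, printed for Kerr
as: "If `ω` and `_{−s}A_{lm}` correspond to a solution for given `(s, l, m)`, another solution can
be obtained by the following replacements: `m → −m`, `ω → −ω*`, `_{−s}A_{lm} → _{−s}A_{l−m}^*`"
(Berti–Cardoso–Starinets 2009, §5.3 (iii), citing Leaver 1985 and Berti–Cardoso–Casals 2006); its
use here: a certified "no mode with `(ω, m) ∈ W(m)`, `λ ∈ Λ□`" for `m > 0` yields the statement for
`−m` with the reflected window `−conj W` and the conjugate `λ`-set (venture `Summits/Ventures/KdS`,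
PLAN A37: the `m < 0` census runs become corollaries). Everything is proved; theorems only, no new
definitions.

## References
* E. Berti, V. Cardoso, A. O. Starinets, *Quasinormal modes of black holes and black branes*,
  Class. Quantum Grav. 26 (2009) 163001 = arXiv:0905.2975, §5.3 (iii). [BertiCardosoStarinets2009]
* H. Suzuki, E. Takasugi, H. Umetsu, Prog. Theor. Phys. 100 (1998) 491, (3.1), (3.7).
  [SuzukiTakasugiUmetsu1998]
* Y. Hatsuda, Class. Quantum Grav. 38 (2020) 025015 = arXiv:2006.08957, (2.5), (2.13), (2.18).
  [Hatsuda2020]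
* M. Casals, R. Teixeira da Costa, Commun. Math. Phys. 394 (2022) 797–832 = arXiv:2105.13329,
  (3.6), (3.8), Def. 3.3, Def. 3.4, Lemma 3.1. [CasalsTeixeiradacosta2022]
-/

noncomputable section

open Complex Set
open scoped ComplexConjugate

namespace Literature.Geometry.Lorentzian.KerrDeSitter

/-! ### The fixed-frequency data under `(ω, m) ↦ (−ω̄, −m)` -/

/-- `K(−ω̄, −m)(r) = −conj K(ω, m)(r)` (`K = ω(r² + a²) − am`, real `a, m, r`).
[cite: Hatsuda2020, (2.14)] -/
theorem radialK_negConj (a : ℝ) (ω : ℂ) (m r : ℝ) :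
    radialK a (-conj ω) (-m) r = -conj (radialK a ω m r) := by
  unfold radialK
  simp only [map_sub, map_mul, Complex.conj_ofReal]
  push_cast
  ring

/-- The horizon exponent `B(r_h) = i(1+α)K(r_h)/Δ'(r_h)` satisfies `B(−ω̄, −m) = conj B(ω, m)`
(`conj i = −i` compensates `K ↦ −conj K`). [cite: Hatsuda2020, (2.18)] -/
theorem horizonB_negConj (M a Λ : ℝ) (ω : ℂ) (m rh : ℝ) :
    horizonB M a Λ (-conj ω) (-m) rh = conj (horizonB M a Λ ω m rh) := by
  unfold horizonB
  rw [radialK_negConj]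
  simp only [map_mul, map_div₀, Complex.conj_I, Complex.conj_ofReal]
  ring

/-- The zeroth-order coefficient of the radial Teukolsky equation (STU (3.7) = Hatsuda (2.13)) is
mapped to its conjugate by `(ω, m, λ) ↦ (−ω̄, −m, λ̄)` (real `M, a, Λ, s`).
[cite: SuzukiTakasugiUmetsu1998, (3.7)] -/
theorem radialPotential_negConj (M a Λ s : ℝ) (ω : ℂ) (m : ℝ) (lam : ℂ) (r : ℝ) :
    radialPotential M a Λ s (-conj ω) (-m) (conj lam) r =
      conj (radialPotential M a Λ s ω m lam r) := by
  unfold radialPotential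
  rw [radialK_negConj]
  simp only [map_add, map_sub, map_mul, map_div₀, map_pow, map_ofNat, Complex.conj_I,
    Complex.conj_ofReal]
  ring

/-- The zeroth-order coefficient of the angular Teukolsky equation (Hatsuda (2.5), `c = aω`) at
`(−ω̄, −m, λ̄, x)` is the conjugate of the coefficient at `(ω, m, λ, −x)`: the terms odd in `x`
(`−2csx`, `(4α/(1+α))smx`, the cross term of `(m + sx)²`) are exactly the terms odd in `(c, m)`.
[cite: Hatsuda2020, (2.5)] -/
theorem angularPotential_negConj (a Λ s : ℝ) (ω : ℂ) (m : ℝ) (lam : ℂ) (x : ℝ) :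
    angularPotential a Λ s (-conj ω) (-m) (conj lam) x =
      conj (angularPotential a Λ s ω m lam (-x)) := by
  unfold angularPotential
  simp only [map_add, map_sub, map_mul, map_pow, map_ofNat,
    Complex.conj_ofReal]
  push_cast
  simp only [neg_sq, mul_neg, neg_mul, neg_neg, sub_neg_eq_add]
  ring

/-- Casals–Teixeira da Costa's separation constant: `λ̄(−ω̄, −m, conj λ) = conj λ̄(ω, m, λ)`
(`2amω` and `a²ω²` are mapped to their conjugates). [cite: CasalsTeixeiradacosta2022, (3.8)] -/
theorem lambdaBar_negConj (a Λ s : ℝ) (ω : ℂ) (m : ℝ) (lam : ℂ) :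
    lambdaBar a Λ s (-conj ω) (-m) (conj lam) = conj (lambdaBar a Λ s ω m lam) := by
  unfold lambdaBar
  simp only [map_add, map_sub, map_mul, map_pow, map_ofNat, Complex.conj_ofReal]
  push_cast
  ring

/-- The master radial coefficient (CTdC (3.8), any `μ`) is mapped to its conjugate by
`(ω, m, λ̄) ↦ (−ω̄, −m, conj λ̄)`. [cite: CasalsTeixeiradacosta2022, (3.8)] -/
theorem masterRadialPotential_negConj (M a Λ s μ : ℝ) (ω : ℂ) (m : ℝ) (lamBar : ℂ) (r : ℝ) :
    masterRadialPotential M a Λ s μ (-conj ω) (-m) (conj lamBar) r =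
      conj (masterRadialPotential M a Λ s μ ω m lamBar r) := by
  unfold masterRadialPotential
  rw [radialK_negConj]
  simp only [map_add, map_sub, map_mul, map_div₀, map_pow, map_ofNat, Complex.conj_I,
    Complex.conj_ofReal]
  push_cast
  ring

/-- The master angular coefficient (CTdC (3.6), any `μ`, parameter `ν` in place of `aω`) at
`(−conj ν, −m, conj λ̄, x)` is the conjugate of the coefficient at `(ν, m, λ̄, −x)`.
[cite: CasalsTeixeiradacosta2022, (3.6)] -/
theorem masterAngularPotential_negConj (a Λ s μ : ℝ) (ν : ℂ) (m : ℝ) (lamBar : ℂ) (x : ℝ) :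
    masterAngularPotential a Λ s μ (-conj ν) (-m) (conj lamBar) x =
      conj (masterAngularPotential a Λ s μ ν m lamBar (-x)) := by
  unfold masterAngularPotential
  simp only [map_add, map_sub, map_mul, map_pow,
    Complex.conj_ofReal]
  push_cast
  simp only [neg_sq, mul_neg, neg_mul, sub_neg_eq_add]
  ring

/-! ### Classical solutions -/

/-- **Radial Teukolsky solutions under conjugation**: if `R` solves the radial equation with
`(ω, m, λ)` on `(r₊, r_c)`, then `conj ∘ R` solves it with `(−ω̄, −m, λ̄)` (the coefficients
`Δ_r`, `(s+1)Δ_r'` are real and the zeroth-order coefficient is conjugated).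
[cite: SuzukiTakasugiUmetsu1998, (3.7)] -/
theorem isRadialTeukolskySolution_negConj {M a Λ s : ℝ} {ω : ℂ} {m : ℝ} {lam : ℂ} {R : ℝ → ℂ}
    (h : IsRadialTeukolskySolution M a Λ s ω m lam R) :
    IsRadialTeukolskySolution M a Λ s (-conj ω) (-m) (conj lam) (fun r => conj (R r)) := by
  obtain ⟨R', R'', hR⟩ := h
  refine ⟨fun r => conj (R' r), fun r => conj (R'' r), fun r hr => ?_⟩
  obtain ⟨h1, h2, h3⟩ := hR r hr
  refine ⟨h1.star, h2.star, ?_⟩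
  have h4 := congrArg conj h3
  rw [map_zero] at h4
  rw [radialPotential_negConj, ← h4]
  simp only [map_add, map_mul, Complex.conj_ofReal]

/-- **Master radial solutions under conjugation** (CTdC (3.8), any `μ`).
[cite: CasalsTeixeiradacosta2022, (3.8)] -/
theorem isMasterRadialSolution_negConj {M a Λ s μ : ℝ} {ω : ℂ} {m : ℝ} {lamBar : ℂ}
    {R : ℝ → ℂ} (h : IsMasterRadialSolution M a Λ s μ ω m lamBar R) :
    IsMasterRadialSolution M a Λ s μ (-conj ω) (-m) (conj lamBar) (fun r => conj (R r)) := by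
  obtain ⟨R', R'', hR⟩ := h
  refine ⟨fun r => conj (R' r), fun r => conj (R'' r), fun r hr => ?_⟩
  obtain ⟨h1, h2, h3⟩ := hR r hr
  refine ⟨h1.star, h2.star, ?_⟩
  have h4 := congrArg conj h3
  rw [map_zero] at h4
  rw [masterRadialPotential_negConj, ← h4]
  simp only [map_add, map_mul, Complex.conj_ofReal]

/-- `x ↦ S(−x)` has derivative `−S'(−x)` (chain rule with `x ↦ −x`). [folklore] -/
private theorem hasDerivAt_comp_neg' {S : ℝ → ℂ} {S'x : ℂ} {x : ℝ}
    (h : HasDerivAt S S'x (-x)) : HasDerivAt (fun y => S (-y)) (-S'x) x := by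
  have := h.scomp x (hasDerivAt_neg (x := x))
  simpa [Function.comp_def] using this

/-- **Angular Teukolsky solutions under conjugation and reflection**: if `S` solves the angular
equation (Hatsuda (2.5)) with `(ω, m, λ)` on `(−1, 1)`, then `x ↦ conj S(−x)` solves it with
`(−ω̄, −m, λ̄)` (the coefficient of `S''` is even in `x`, that of `S'` is odd).
[cite: Hatsuda2020, (2.5)] -/
theorem isAngularTeukolskySolution_negConj {a Λ s : ℝ} {ω : ℂ} {m : ℝ} {lam : ℂ} {S : ℝ → ℂ}
    (h : IsAngularTeukolskySolution a Λ s ω m lam S) :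
    IsAngularTeukolskySolution a Λ s (-conj ω) (-m) (conj lam) (fun x => conj (S (-x))) := by
  obtain ⟨S', S'', hS⟩ := h
  refine ⟨fun x => -conj (S' (-x)), fun x => conj (S'' (-x)), fun x hx => ?_⟩
  have hx' : -x ∈ Ioo (-1 : ℝ) 1 := ⟨by linarith [hx.2], by linarith [hx.1]⟩
  obtain ⟨h1, h2, h3⟩ := hS (-x) hx'
  have d1 : HasDerivAt (fun y => conj (S (-y))) (-conj (S' (-x))) x := by
    simpa using (hasDerivAt_comp_neg' h1).star
  have d2 : HasDerivAt (fun y => -conj (S' (-y))) (conj (S'' (-x))) x := by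
    simpa [Pi.neg_def] using (hasDerivAt_comp_neg' h2).star.neg
  refine ⟨d1, d2, ?_⟩
  have h4 := congrArg conj h3
  rw [map_zero] at h4
  rw [angularPotential_negConj, ← h4]
  simp only [map_add, map_mul, Complex.conj_ofReal]
  push_cast
  simp only [neg_sq, mul_neg]
  ring

/-- **Master angular solutions under conjugation and reflection** (CTdC (3.6), any `μ`,
`ν ↦ −conj ν`). [cite: CasalsTeixeiradacosta2022, (3.6)] -/
theorem isMasterAngularSolution_negConj {a Λ s μ : ℝ} {ν : ℂ} {m : ℝ} {lamBar : ℂ} {S : ℝ → ℂ}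
    (h : IsMasterAngularSolution a Λ s μ ν m lamBar S) :
    IsMasterAngularSolution a Λ s μ (-conj ν) (-m) (conj lamBar) (fun x => conj (S (-x))) := by
  obtain ⟨S', S'', hS⟩ := h
  refine ⟨fun x => -conj (S' (-x)), fun x => conj (S'' (-x)), fun x hx => ?_⟩
  have hx' : -x ∈ Ioo (-1 : ℝ) 1 := ⟨by linarith [hx.2], by linarith [hx.1]⟩
  obtain ⟨h1, h2, h3⟩ := hS (-x) hx'
  have d1 : HasDerivAt (fun y => conj (S (-y))) (-conj (S' (-x))) x := by
    simpa using (hasDerivAt_comp_neg' h1).star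
  have d2 : HasDerivAt (fun y => -conj (S' (-y))) (conj (S'' (-x))) x := by
    simpa [Pi.neg_def] using (hasDerivAt_comp_neg' h2).star.neg
  refine ⟨d1, d2, ?_⟩
  have h4 := congrArg conj h3
  rw [map_zero] at h4
  rw [masterAngularPotential_negConj, ← h4]
  simp only [map_add, map_mul, Complex.conj_ofReal]
  push_cast
  simp only [neg_sq, mul_neg]
  ring

/-! ### Boundary and regularity conditions -/

/-- `t^{conj z} = conj (t^z)` for real `t ≥ 0` (the argument of `t` is `0 ≠ π`). [folklore] -/
private theorem ofReal_cpow_conj_eq {t : ℝ} (ht : 0 ≤ t) (z : ℂ) :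
    ((t : ℝ) : ℂ) ^ conj z = conj (((t : ℝ) : ℂ) ^ z) := by
  rw [Complex.cpow_conj _ _ (by rw [Complex.arg_ofReal_of_nonneg ht]; exact Real.pi_ne_zero.symm),
    Complex.conj_ofReal]

/-- **Conjugation preserves the ingoing condition at `𝓗⁺`** with `(ω, m) ↦ (−ω̄, −m)`: if
`R(r)(r − r₊)^{s + B(r₊)} = f(r)` on a collar with `f` smooth across `r₊`, then
`conj R(r)(r − r₊)^{s + conj B(r₊)} = conj f(r)` and `conj B(r₊; ω, m) = B(r₊; −ω̄, −m)`.
[cite: CasalsTeixeiradacosta2022, Definition 3.3] -/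
theorem isIngoingAtEventHorizon_negConj {M a Λ s : ℝ} {ω : ℂ} {m : ℝ} {R : ℝ → ℂ}
    (h : IsIngoingAtEventHorizon M a Λ s ω m R) :
    IsIngoingAtEventHorizon M a Λ s (-conj ω) (-m) (fun r => conj (R r)) := by
  obtain ⟨ε, hε, f, hf, hRf⟩ := h
  refine ⟨ε, hε, fun r => conj (f r), Complex.conjCLE.contDiff.comp_contDiffOn hf,
    fun r hr => ?_⟩
  dsimp only
  rw [horizonB_negConj, ← hRf r hr, map_mul]
  congr 1
  rw [← ofReal_cpow_conj_eq (sub_pos.2 hr.1).le, map_add, Complex.conj_ofReal]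

/-- **Conjugation preserves the outgoing condition at `𝓗⁺_c`** with `(ω, m) ↦ (−ω̄, −m)`:
`conj R(r)(r_c − r)^{−conj B(r_c)} = conj f(r)`. [cite: CasalsTeixeiradacosta2022, Definition 3.3] -/
theorem isOutgoingAtCosmoHorizon_negConj {M a Λ : ℝ} {ω : ℂ} {m : ℝ} {R : ℝ → ℂ}
    (h : IsOutgoingAtCosmoHorizon M a Λ ω m R) :
    IsOutgoingAtCosmoHorizon M a Λ (-conj ω) (-m) (fun r => conj (R r)) := by
  obtain ⟨ε, hε, f, hf, hRf⟩ := h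
  refine ⟨ε, hε, fun r => conj (f r), Complex.conjCLE.contDiff.comp_contDiffOn hf,
    fun r hr => ?_⟩
  dsimp only
  rw [horizonB_negConj, ← hRf r hr, map_mul]
  congr 1
  rw [← ofReal_cpow_conj_eq (sub_pos.2 hr.2).le, map_neg]

/-- **Regularity at the poles is preserved by `S ↦ conj S(−·)`, `m ↦ −m`**: the admissible
exponents `|m − s|/2` at `x = −1` and `|m + s|/2` at `x = 1` are exchanged by `(m, x) ↦ (−m, −x)`,
and the real powers `(1 ± x)^{|·|/2}` are self-conjugate. [cite: CasalsTeixeiradacosta2022, Lemma 3.1] -/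
theorem isRegularAtPoles_negConj {s m : ℝ} {S : ℝ → ℂ} (h : IsRegularAtPoles s m S) :
    IsRegularAtPoles s (-m) (fun x => conj (S (-x))) := by
  obtain ⟨⟨ε₁, hε₁, g₁, hg₁, hS₁⟩, ⟨ε₂, hε₂, g₂, hg₂, hS₂⟩⟩ := h
  have hneg : ContDiff ℝ ((⊤ : ℕ∞) : WithTop ℕ∞) (fun y : ℝ => -y) := contDiff_neg
  constructor
  · -- near `x = −1` use the data of `S` near `x = 1`
    refine ⟨ε₂, hε₂, fun x => conj (g₂ (-x)), ?_, fun x hx => ?_⟩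
    · refine Complex.conjCLE.contDiff.comp_contDiffOn (hg₂.comp hneg.contDiffOn ?_)
      intro x hx
      simp only [mem_Ioo] at hx ⊢
      constructor <;> linarith
    · have hx' : -x ∈ Ioo (1 - ε₂) 1 := by
        simp only [mem_Ioo] at hx ⊢
        constructor <;> linarith
      have habs : |-m - s| = |m + s| := by
        rw [← abs_neg]; ring_nf
      dsimp only
      rw [hS₂ (-x) hx', map_mul, habs, sub_neg_eq_add,
        ← ofReal_cpow_conj_eq (by linarith [hx.1] : (0 : ℝ) ≤ 1 + x), Complex.conj_ofReal]
  · -- near `x = 1` use the data of `S` near `x = −1`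
    refine ⟨ε₁, hε₁, fun x => conj (g₁ (-x)), ?_, fun x hx => ?_⟩
    · refine Complex.conjCLE.contDiff.comp_contDiffOn (hg₁.comp hneg.contDiffOn ?_)
      intro x hx
      simp only [mem_Ioo] at hx ⊢
      constructor <;> linarith
    · have hx' : -x ∈ Ioo (-1 : ℝ) (-1 + ε₁) := by
        simp only [mem_Ioo] at hx ⊢
        constructor <;> linarith
      have habs : |-m + s| = |m - s| := by
        rw [← abs_neg]; ring_nf
      have e : (1 + -x : ℝ) = 1 - x := by ring
      dsimp only
      rw [hS₁ (-x) hx', map_mul, habs, e,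
        ← ofReal_cpow_conj_eq (by linarith [hx.2] : (0 : ℝ) ≤ 1 - x), Complex.conj_ofReal]

/-- **Angular eigenvalues under `(ω, m, λ) ↦ (−ω̄, −m, λ̄)`** (the eigenfunction `S` becomes
`conj S(−·)`): "`_{s}A_{lm} → _{s}A_{l,−m}^*`". [cite: BertiCardosoStarinets2009, §5.3 (iii)] -/
theorem isAngularEigenvalue_negConj {a Λ s : ℝ} {ω : ℂ} {m : ℝ} {lam : ℂ}
    (h : IsAngularEigenvalue a Λ s ω m lam) :
    IsAngularEigenvalue a Λ s (-conj ω) (-m) (conj lam) := by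
  obtain ⟨S, hS, hreg, x, hx, hSx⟩ := h
  refine ⟨fun y => conj (S (-y)), isAngularTeukolskySolution_negConj hS,
    isRegularAtPoles_negConj hreg, -x, ⟨by linarith [hx.2], by linarith [hx.1]⟩, ?_⟩
  simpa using hSx

/-- **Master angular eigenvalues under `(ν, m, λ̄) ↦ (−conj ν, −m, conj λ̄)`** (any `μ`).
[cite: CasalsTeixeiradacosta2022, Lemma 3.1] -/
theorem isMasterAngularEigenvalue_negConj {a Λ s μ : ℝ} {ν : ℂ} {m : ℝ} {lamBar : ℂ}
    (h : IsMasterAngularEigenvalue a Λ s μ ν m lamBar) :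
    IsMasterAngularEigenvalue a Λ s μ (-conj ν) (-m) (conj lamBar) := by
  obtain ⟨S, hS, hreg, x, hx, hSx⟩ := h
  refine ⟨fun y => conj (S (-y)), isMasterAngularSolution_negConj hS,
    isRegularAtPoles_negConj hreg, -x, ⟨by linarith [hx.2], by linarith [hx.1]⟩, ?_⟩
  simpa using hSx

/-! ### Mode solutions, `HasMode`, `NoModeIn` -/

/-- **Mode solutions under conjugation**: `(ω, m, λ, R)` is a Teukolsky mode solution iff... — the
forward direction: `(−ω̄, −m, λ̄, conj R)` is one ("`m → −m`, `ω → −ω*`, `A_{lm} → A_{l−m}^*`").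
[cite: BertiCardosoStarinets2009, §5.3 (iii)] -/
theorem isModeSolution_negConj {M a Λ s : ℝ} {ω : ℂ} {m : ℝ} {lam : ℂ} {R : ℝ → ℂ}
    (h : IsModeSolution M a Λ s ω m lam R) :
    IsModeSolution M a Λ s (-conj ω) (-m) (conj lam) (fun r => conj (R r)) := by
  obtain ⟨hev, hrad, hin, hout, r, hr, hR⟩ := h
  exact ⟨isAngularEigenvalue_negConj hev, isRadialTeukolskySolution_negConj hrad,
    isIngoingAtEventHorizon_negConj hin, isOutgoingAtCosmoHorizon_negConj hout, r, hr,
    by simpa using hR⟩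

/-- **Existence of a mode solution with prescribed separation constant is invariant**:
there is a radial function making `(−ω̄, −m, λ̄)` a mode solution iff there is one for `(ω, m, λ)`
(the map is an involution). This is the form consumed by λ-truncated "no mode" statements
(`∀ λ ∈ Λ□, ∀ R, ¬IsModeSolution …`: the `−m` statement with the conjugate `λ`-set follows from the
`m` statement). [cite: BertiCardosoStarinets2009, §5.3 (iii)] -/
theorem exists_isModeSolution_negConj_iff (M a Λ s : ℝ) (ω : ℂ) (m : ℝ) (lam : ℂ) :
    (∃ R, IsModeSolution M a Λ s (-conj ω) (-m) (conj lam) R) ↔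
      ∃ R, IsModeSolution M a Λ s ω m lam R := by
  constructor
  · rintro ⟨R, hR⟩
    refine ⟨fun r => conj (R r), ?_⟩
    simpa using isModeSolution_negConj hR
  · rintro ⟨R, hR⟩
    exact ⟨fun r => conj (R r), isModeSolution_negConj hR⟩

/-- **No mode solution at `(ω, m, λ)` from none at `(−ω̄, −m, λ̄)`** (pointwise transfer for
λ-truncated certificates). [cite: BertiCardosoStarinets2009, §5.3 (iii)] -/
theorem not_isModeSolution_of_negConj {M a Λ s : ℝ} {ω : ℂ} {m : ℝ} {lam : ℂ}
    (h : ∀ R, ¬IsModeSolution M a Λ s (-conj ω) (-m) (conj lam) R) (R : ℝ → ℂ) :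
    ¬IsModeSolution M a Λ s ω m lam R :=
  fun hR => h _ (isModeSolution_negConj hR)

/-- `(ω, m)` carries a mode ⇒ `(−ω̄, −m)` carries a mode. [cite: BertiCardosoStarinets2009, §5.3 (iii)] -/
theorem HasMode.negConj {M a Λ s : ℝ} {ω : ℂ} {m : ℝ} (h : HasMode M a Λ s ω m) :
    HasMode M a Λ s (-conj ω) (-m) := by
  obtain ⟨lam, R, hR⟩ := h
  exact ⟨conj lam, fun r => conj (R r), isModeSolution_negConj hR⟩

/-- **`HasMode` is invariant under `(ω, m) ↦ (−ω̄, −m)`** (the map is an involution; no hypothesis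
on the spin). [cite: BertiCardosoStarinets2009, §5.3 (iii)] -/
theorem hasMode_negConj_iff (M a Λ s : ℝ) (ω : ℂ) (m : ℝ) :
    HasMode M a Λ s (-conj ω) (-m) ↔ HasMode M a Λ s ω m := by
  refine ⟨fun h => ?_, HasMode.negConj⟩
  simpa using h.negConj

/-- **"No mode" transfers to the reflected window**: if no admissible `(ω, m) ∈ W` carries a mode
and `2s ∈ ℤ` (so that `m − s ∈ ℤ ↔ −m − s ∈ ℤ`), then no admissible `(ω', m')` in the image
`{(−ω̄, −m) : (ω, m) ∈ W}` carries a mode. This is how a certificate for `m > 0` yields the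
`m < 0` statement. [cite: BertiCardosoStarinets2009, §5.3 (iii)] -/
theorem noModeIn_negConj {M a Λ s : ℝ} (hs : ∃ k : ℤ, 2 * s = k) {W : Set (ℂ × ℝ)}
    (h : NoModeIn M a Λ s W) :
    NoModeIn M a Λ s ((fun p : ℂ × ℝ => (-conj p.1, -p.2)) '' W) := by
  rintro ω' m' ⟨⟨ω, m⟩, hW, he⟩ ⟨k, hk⟩
  simp only [Prod.mk.injEq] at he
  obtain ⟨rfl, rfl⟩ := he
  rw [hasMode_negConj_iff]
  obtain ⟨j, hj⟩ := hs
  refine h ω m hW ⟨-k - j, ?_⟩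
  push_cast
  linarith

/-- The reflected window of the replacement rule "`m → −m`, `ω → −ω*`", membership form:
`(ω, m)` lies in the image of `W` under `(ω, m) ↦ (−ω̄, −m)` iff `(−ω̄, −m) ∈ W` (the map is an
involution; `Re` changes sign, `Im` is kept). [cite: BertiCardosoStarinets2009, §5.3 (iii)] -/
theorem mem_image_negConj_iff (W : Set (ℂ × ℝ)) (ω : ℂ) (m : ℝ) :
    (ω, m) ∈ (fun p : ℂ × ℝ => (-conj p.1, -p.2)) '' W ↔ (-conj ω, -m) ∈ W := by
  constructor
  · rintro ⟨⟨ω₀, m₀⟩, hW, he⟩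
    simp only [Prod.mk.injEq] at he
    obtain ⟨rfl, rfl⟩ := he
    simpa using hW
  · intro hW
    exact ⟨(-conj ω, -m), hW, by simp⟩

/-- **"No mode" for `−m` from "no mode" for `m`, pointwise form**: if `(−ω̄, −m)` is not a mode
frequency then neither is `(ω, m)` — contrapositive packaging of `hasMode_negConj_iff` for use with
explicit windows (`Re ω ↦ −Re ω`, `Im ω ↦ Im ω`). [cite: BertiCardosoStarinets2009, §5.3 (iii)] -/
theorem not_hasMode_of_negConj {M a Λ s : ℝ} {ω : ℂ} {m : ℝ}
    (h : ¬HasMode M a Λ s (-conj ω) (-m)) : ¬HasMode M a Λ s ω m :=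
  fun h' => h h'.negConj

/-! ### The master system (`s = 0`, Klein–Gordon parameter `μ`, and general `s`) -/

/-- **Master mode solutions under conjugation** (CTdC Def. 3.4 with parameter `μ`; `ν = aω ↦
a(−ω̄) = −conj(aω)`). [cite: CasalsTeixeiradacosta2022, Definition 3.4] -/
theorem isMasterModeSolution_negConj {M a Λ s μ : ℝ} {ω : ℂ} {m : ℝ} {lamBar : ℂ} {R : ℝ → ℂ}
    (h : IsMasterModeSolution M a Λ s μ ω m lamBar R) :
    IsMasterModeSolution M a Λ s μ (-conj ω) (-m) (conj lamBar) (fun r => conj (R r)) := by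
  obtain ⟨hev, hrad, hin, hout, r, hr, hR⟩ := h
  have hν : (a : ℂ) * (-conj ω) = -conj ((a : ℂ) * ω) := by
    simp only [map_mul, Complex.conj_ofReal, mul_neg]
  refine ⟨?_, isMasterRadialSolution_negConj hrad, isIngoingAtEventHorizon_negConj hin,
    isOutgoingAtCosmoHorizon_negConj hout, r, hr, by simpa using hR⟩
  rw [hν]
  exact isMasterAngularEigenvalue_negConj hev

/-- Existence of a master mode solution with prescribed `λ̄` is invariant under
`(ω, m, λ̄) ↦ (−ω̄, −m, conj λ̄)` (any `s, μ`). [cite: CasalsTeixeiradacosta2022, Definition 3.4] -/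
theorem exists_isMasterModeSolution_negConj_iff (M a Λ s μ : ℝ) (ω : ℂ) (m : ℝ) (lamBar : ℂ) :
    (∃ R, IsMasterModeSolution M a Λ s μ (-conj ω) (-m) (conj lamBar) R) ↔
      ∃ R, IsMasterModeSolution M a Λ s μ ω m lamBar R := by
  constructor
  · rintro ⟨R, hR⟩
    refine ⟨fun r => conj (R r), ?_⟩
    simpa using isMasterModeSolution_negConj hR
  · rintro ⟨R, hR⟩
    exact ⟨fun r => conj (R r), isMasterModeSolution_negConj hR⟩

/-- No master mode solution at `(ω, m, λ̄)` from none at `(−ω̄, −m, conj λ̄)` (pointwise transfer,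
any `s, μ`). [cite: CasalsTeixeiradacosta2022, Definition 3.4] -/
theorem not_isMasterModeSolution_of_negConj {M a Λ s μ : ℝ} {ω : ℂ} {m : ℝ} {lamBar : ℂ}
    (h : ∀ R, ¬IsMasterModeSolution M a Λ s μ (-conj ω) (-m) (conj lamBar) R) (R : ℝ → ℂ) :
    ¬IsMasterModeSolution M a Λ s μ ω m lamBar R :=
  fun hR => h _ (isMasterModeSolution_negConj hR)

/-- `(ω, m)` carries a master-system mode ⇒ `(−ω̄, −m)` does (any `s, μ`).
[cite: CasalsTeixeiradacosta2022, Definition 3.4] -/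
theorem HasMasterMode.negConj {M a Λ s μ : ℝ} {ω : ℂ} {m : ℝ} (h : HasMasterMode M a Λ s μ ω m) :
    HasMasterMode M a Λ s μ (-conj ω) (-m) := by
  obtain ⟨lamBar, R, hR⟩ := h
  exact ⟨conj lamBar, fun r => conj (R r), isMasterModeSolution_negConj hR⟩

/-- **`HasMasterMode` is invariant under `(ω, m) ↦ (−ω̄, −m)`** (any `s, μ`).
[cite: CasalsTeixeiradacosta2022, Definition 3.4] -/
theorem hasMasterMode_negConj_iff (M a Λ s μ : ℝ) (ω : ℂ) (m : ℝ) :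
    HasMasterMode M a Λ s μ (-conj ω) (-m) ↔ HasMasterMode M a Λ s μ ω m := by
  refine ⟨fun h => ?_, HasMasterMode.negConj⟩
  simpa using h.negConj

/-- **"No master mode" transfers to the reflected window** (`2s ∈ ℤ`; for the scalar cases
`s = 0` this hypothesis is trivially met). [cite: CasalsTeixeiradacosta2022, Definition 3.4] -/
theorem noMasterModeIn_negConj {M a Λ s μ : ℝ} (hs : ∃ k : ℤ, 2 * s = k) {W : Set (ℂ × ℝ)}
    (h : NoMasterModeIn M a Λ s μ W) :
    NoMasterModeIn M a Λ s μ ((fun p : ℂ × ℝ => (-conj p.1, -p.2)) '' W) := by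
  rintro ω' m' ⟨⟨ω, m⟩, hW, he⟩ ⟨k, hk⟩
  simp only [Prod.mk.injEq] at he
  obtain ⟨rfl, rfl⟩ := he
  rw [hasMasterMode_negConj_iff]
  obtain ⟨j, hj⟩ := hs
  refine h ω m hW ⟨-k - j, ?_⟩
  push_cast
  linarith

/-- Scalar case packaging (`s = 0`: admissibility `m ∈ ℤ` is symmetric): no master mode in `W`
⇒ no master mode in the reflected window. [cite: CasalsTeixeiradacosta2022, Definition 3.4] -/
theorem noMasterModeIn_negConj_zero {M a Λ μ : ℝ} {W : Set (ℂ × ℝ)}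
    (h : NoMasterModeIn M a Λ 0 μ W) :
    NoMasterModeIn M a Λ 0 μ ((fun p : ℂ × ℝ => (-conj p.1, -p.2)) '' W) :=
  noMasterModeIn_negConj ⟨0, by simp⟩ h

/-! ### σ as a bijection of mode data (for COUNT / completeness statements)

The map `σ` is an involution, so besides transporting "no mode" it identifies the SETS of angular
eigenvalues and of mode pairs `(ω, λ)` for `m` and `−m`: images under `λ ↦ conj λ`,
`(ω, λ) ↦ (−conj ω, conj λ)`, with equal cardinalities (`Set.encard`). This is what a λ-cover or
branch-COUNT certificate filed for `m > 0` transfers to `−m`. -/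

/-- `IsAngularEigenvalue` is invariant under `(ω, m, λ) ↦ (−ω̄, −m, λ̄)` (iff form; the map is an
involution). [cite: BertiCardosoStarinets2009, §5.3 (iii)] -/
theorem isAngularEigenvalue_negConj_iff (a Λ s : ℝ) (ω : ℂ) (m : ℝ) (lam : ℂ) :
    IsAngularEigenvalue a Λ s (-conj ω) (-m) (conj lam) ↔ IsAngularEigenvalue a Λ s ω m lam := by
  refine ⟨fun h => ?_, isAngularEigenvalue_negConj⟩
  simpa using isAngularEigenvalue_negConj h

/-- `IsModeSolution` is invariant under `σ` (iff form, same radial function up to conjugation).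
[cite: BertiCardosoStarinets2009, §5.3 (iii)] -/
theorem isModeSolution_negConj_iff (M a Λ s : ℝ) (ω : ℂ) (m : ℝ) (lam : ℂ) (R : ℝ → ℂ) :
    IsModeSolution M a Λ s (-conj ω) (-m) (conj lam) (fun r => conj (R r)) ↔
      IsModeSolution M a Λ s ω m lam R := by
  refine ⟨fun h => ?_, isModeSolution_negConj⟩
  simpa using isModeSolution_negConj h

/-- **The angular eigenvalues in a λ-set `L` for `(−ω̄, −m)` are the conjugates of those in
`conj⁻¹ L`… stated as an image**: `conj '' {λ ∈ L | eigenvalue at (ω, m)} = {λ ∈ conj '' L |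
eigenvalue at (−ω̄, −m)}` ("`ₛA_{lm} → ₛA*_{l,−m}`"). [cite: BertiCardosoStarinets2009, §5.3 (i), (iii)] -/
theorem conj_image_angularEigenvalues (a Λ s : ℝ) (ω : ℂ) (m : ℝ) (L : Set ℂ) :
    conj '' {lam | lam ∈ L ∧ IsAngularEigenvalue a Λ s ω m lam} =
      {lam | lam ∈ conj '' L ∧ IsAngularEigenvalue a Λ s (-conj ω) (-m) lam} := by
  ext lam
  constructor
  · rintro ⟨lam₀, ⟨hL, hev⟩, rfl⟩
    exact ⟨⟨lam₀, hL, rfl⟩, isAngularEigenvalue_negConj hev⟩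
  · rintro ⟨⟨lam₀, hL, rfl⟩, hev⟩
    exact ⟨lam₀, ⟨hL, (isAngularEigenvalue_negConj_iff a Λ s ω m lam₀).1 hev⟩, rfl⟩

/-- **Equal COUNT of angular eigenvalue branches** in `L` at `(ω, m)` and in `conj '' L` at
`(−ω̄, −m)` (`Set.encard`; conjugation is injective). [cite: BertiCardosoStarinets2009, §5.3 (i), (iii)] -/
theorem encard_angularEigenvalues_negConj (a Λ s : ℝ) (ω : ℂ) (m : ℝ) (L : Set ℂ) :
    {lam | lam ∈ conj '' L ∧ IsAngularEigenvalue a Λ s (-conj ω) (-m) lam}.encard =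
      {lam | lam ∈ L ∧ IsAngularEigenvalue a Λ s ω m lam}.encard := by
  rw [← conj_image_angularEigenvalues]
  exact ((RingHom.injective (starRingEnd ℂ)).injOn).encard_image

/-- **The mode pairs `(ω, λ)` for `−m` in the reflected frequency set and the conjugate λ-set are the
`σ`-images of the mode pairs for `m`**: with `σ(ω, λ) = (−ω̄, λ̄)`,
`σ '' {(ω, λ) ∈ V × L : ∃ R, mode at m} = {(ω, λ) ∈ (−conj) '' V × conj '' L : ∃ R, mode at −m}`.
[cite: BertiCardosoStarinets2009, §5.3 (iii)] -/
theorem image_modePairs_negConj (M a Λ s : ℝ) (m : ℝ) (V L : Set ℂ) :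
    (fun p : ℂ × ℂ => (-conj p.1, conj p.2)) ''
        {p | p.1 ∈ V ∧ p.2 ∈ L ∧ ∃ R, IsModeSolution M a Λ s p.1 m p.2 R} =
      {p | p.1 ∈ (fun ω => -conj ω) '' V ∧ p.2 ∈ conj '' L ∧
        ∃ R, IsModeSolution M a Λ s p.1 (-m) p.2 R} := by
  ext ⟨ω, lam⟩
  constructor
  · rintro ⟨⟨ω₀, lam₀⟩, ⟨hV, hL, hR⟩, he⟩
    simp only [Prod.mk.injEq] at he
    obtain ⟨rfl, rfl⟩ := he
    exact ⟨⟨ω₀, hV, rfl⟩, ⟨lam₀, hL, rfl⟩, (exists_isModeSolution_negConj_iff M a Λ s ω₀ m lam₀).2 hR⟩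
  · rintro ⟨⟨ω₀, hV, rfl⟩, ⟨lam₀, hL, rfl⟩, hR⟩
    exact ⟨(ω₀, lam₀), ⟨hV, hL, (exists_isModeSolution_negConj_iff M a Λ s ω₀ m lam₀).1 hR⟩, rfl⟩

/-- **Equal COUNT of mode pairs** for `m` in `V × L` and for `−m` in the reflected/conjugated sets
(`Set.encard`; `σ` is injective). [cite: BertiCardosoStarinets2009, §5.3 (iii)] -/
theorem encard_modePairs_negConj (M a Λ s : ℝ) (m : ℝ) (V L : Set ℂ) :
    {p : ℂ × ℂ | p.1 ∈ (fun ω => -conj ω) '' V ∧ p.2 ∈ conj '' L ∧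
        ∃ R, IsModeSolution M a Λ s p.1 (-m) p.2 R}.encard =
      {p : ℂ × ℂ | p.1 ∈ V ∧ p.2 ∈ L ∧ ∃ R, IsModeSolution M a Λ s p.1 m p.2 R}.encard := by
  rw [← image_modePairs_negConj]
  refine (Set.injOn_of_injective ?_).encard_image
  intro p q hpq
  simp only [Prod.mk.injEq, neg_inj] at hpq
  exact Prod.ext ((RingHom.injective (starRingEnd ℂ)) hpq.1) ((RingHom.injective (starRingEnd ℂ)) hpq.2)

/-- Master-system version: `IsMasterAngularEigenvalue` is invariant under `(ν, m, λ̄) ↦ (−conj ν, −m, conj λ̄)`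
(iff form). [cite: CasalsTeixeiradacosta2022, Lemma 3.1] -/
theorem isMasterAngularEigenvalue_negConj_iff (a Λ s μ : ℝ) (ν : ℂ) (m : ℝ) (lamBar : ℂ) :
    IsMasterAngularEigenvalue a Λ s μ (-conj ν) (-m) (conj lamBar) ↔
      IsMasterAngularEigenvalue a Λ s μ ν m lamBar := by
  refine ⟨fun h => ?_, isMasterAngularEigenvalue_negConj⟩
  simpa using isMasterAngularEigenvalue_negConj h

/-- Master-system version of the equal COUNT of angular eigenvalue branches (any `μ`).
[cite: CasalsTeixeiradacosta2022, Lemma 3.1] -/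
theorem encard_masterAngularEigenvalues_negConj (a Λ s μ : ℝ) (ν : ℂ) (m : ℝ) (L : Set ℂ) :
    {lam | lam ∈ conj '' L ∧ IsMasterAngularEigenvalue a Λ s μ (-conj ν) (-m) lam}.encard =
      {lam | lam ∈ L ∧ IsMasterAngularEigenvalue a Λ s μ ν m lam}.encard := by
  have himg : conj '' {lam | lam ∈ L ∧ IsMasterAngularEigenvalue a Λ s μ ν m lam} =
      {lam | lam ∈ conj '' L ∧ IsMasterAngularEigenvalue a Λ s μ (-conj ν) (-m) lam} := by
    ext lam
    constructor
    · rintro ⟨lam₀, ⟨hL, hev⟩, rfl⟩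
      exact ⟨⟨lam₀, hL, rfl⟩, isMasterAngularEigenvalue_negConj hev⟩
    · rintro ⟨⟨lam₀, hL, rfl⟩, hev⟩
      exact ⟨lam₀, ⟨hL, (isMasterAngularEigenvalue_negConj_iff a Λ s μ ν m lam₀).1 hev⟩, rfl⟩
  rw [← himg]
  exact ((RingHom.injective (starRingEnd ℂ)).injOn).encard_image

end Literature.Geometry.Lorentzian.KerrDeSitter

end
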